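import Summits.AtomisticToContinuum.FouriersLaw.Theorems.BondHeatUncertaintyBoundedResponseOddTransversality
import Summits.AtomisticToContinuum.FouriersLaw.Theorems.BondHeatUncertaintyBoundedResponseTransientBandA
import Summits.AtomisticToContinuum.FouriersLaw.Theorems.BondHeatUncertaintyLightConeBondHeatGreenKuboDip
import Summits.AtomisticToContinuum.FouriersLaw.Theorems.BondHeatUncertaintyLightConeBondHeatAutocorrelation
import HarnessLib

/-!
# BondHeatUncertainty / BoundedResponse — «HeatSpreading»: the Einstein–Helfand ladder of the blocker (lens-1 g104, NODE 104)

Blocker 11071 `BoundedResponse` (⟺ `OhmicFloor` ⟺ `ExponentFloor 1`, i.e. `E_N = O(1/N)`).  The odd-norm / Cauchy–Schwarz ladders of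
gens 99–103 top out at `ExponentFloor (1/2)` (`oddCorrectorGrade_zero_iff`): the missing `√N` is TIME-SIDE decorrelation of the current.
This node types that decorrelation in the currency of the TOTAL current `J = ∑_i j_i` of the equilibrium open chain (`μ_T`, constructed
kernels `P_s`), where BOTH signs are free, through the Einstein–Helfand identity.  PART A (§0–§4, fixed `N`, everything PROVED):

* `totalAutocorr`  `C_N(s) = ∫ J·(P_sJ) dμ_T` — VERBATIM the integrand of conjunct B of the PROVED route item `OddSectorIrreversibility.CorrectorTheory`;
* `heatSpread` `V_N(t) = 2∫₀ᵗ(t−s)C_N(s)ds = E_{μ_T⊗W}[(∫₀ᵗJ(z_s)ds)²] ≥ 0` — the Einstein–Helfand second moment of the time-integrated total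
  current = (up to the static block-energy telescoping) the MEAN-SQUARE DISPLACEMENT OF THE ENERGY CENTROID, the «heat spreading» functional
  (`V_N'' = 2C_N`: the excess-energy-spreading ⟷ current-autocorrelation dictionary);
* `gkTail`     `Tr_N(t) = ∫_{(0,∞)} min(s,t)C_N(s)ds = ∫₀ᵗ(G_N − ∫₀ʳC_N)dr` — the accumulated SHORTFALL of the running Green–Kubo integral;
* `totalGK`    `G_N = ∫_{(0,∞)} C_N = γT²(N−1)²·E_N ≥ 0` (`totalGK_eq`: `CorrectorTheory_proof` + `ResponseIdentity`), so 11071 ⟺ `G_N = O(N)`;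
  `|C_N| ≤ ‖J‖²_{μ_T}` (contraction), `V_N(t) ≤ ‖J‖²t²`, the EINSTEIN–HELFAND IDENTITY `t·G_N = V_N(t)/2 + Tr_N(t)`, `Tr_N(t) ≤ tG_N`,
  and Einstein–Helfand = Green–Kubo at fixed `N`: `Tr_N(t)/t → 0`, `V_N(t)/(2t) → G_N` (dominated convergence).

PART B (§5–§12, the graded `N`-uniform pieces and their proved seams):

* (HSᵂ_b) `HeatSpreadWindow b` — `V_N(t) ≤ C·N·t^b` on `[1, cN²]` (SPREADING EXPONENT; `b = 2` PROVED = ballistic/free; `b = 1` = NORMAL HEAT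
  SPREADING up to the Thouless time, phonon-FALSE; `1 < b < 2` superdiffusive); (HSᴾ_h) `HeatSpreadPoint h` — `V_N(cN²) ≤ C·N^h` (`h = 5` PROVED;
  `h = 3` normal; (HSᵂ_b) ⟹ (HSᴾ_{1+2b})); (HSᵁ) `HeatSpreadUniform` — `V_N(t) ≤ C·N·t` for ALL `t ≥ 1`.
* (TCᶜ_g) `GKTailCeiling g` — `Tr_N(cN²) ≤ C·N^g` for every `c > 0` (`g = 4` PROVED; **`g = 3` ⟸ 11071 PROVED**: the ceiling side is a CONSEQUENCE
  of the blocker — in the escape currency the analogous (U) is open); (TFᶜ_g) `GKTailFloor g` — `Tr_N(cN²) ≥ −C·N^g` (`g = 5` PROVED; `g = 3` the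
  twin of `TransientBand.TransientFloor 1`).
* (TBC) `TotalBondComparison` — fixed-`N` telescoping `V_N(t) ≤ 2(N−1)²·V_N(b,t) + C·N³` onto the single-bond heat variance of the (S) items.

PROVED SEAMS: the graded door **(HSᴾ_h) ∧ (TCᶜ_g) ⟹ `ExponentFloor (4 − max h g)`**, at `h = g = 3` **⟹ 11071**; necessity **11071 ⟹ (TCᶜ_3)** and
**11071 ∧ (TFᶜ_3) ⟹ (HSᴾ_3)**; the top of the ladder **(HSᵁ) ⟹ 11071** (no transient piece); the CROSS-BRANCH SEAM to the route's other open crux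
(S) = `SubdiffusiveBondHeat` (9120): **(S) ∧ (TBC) ⟹ (HSᴾ_3)**, hence **(S) ∧ (TBC) ∧ (TCᶜ_3) ⟹ 11071** and **(S) ∧ (TBC) ⟹ (11071 ⟺ (TCᶜ_3))** —
given the (S) branch and a fixed-`N` telescoping, the N_F blocker IS the Green–Kubo tail ceiling, a phonon-compatible statement NECESSARY for
11071.  WHY NOVEL: no tree file carries the Einstein–Helfand / mean-square-displacement functional of the TOTAL current or its `min(s,t)` tail
companion (`TransientBand` grades the ESCAPE-step response `R_N`, `EscapeGrading` the exponent of `E_N`, `OddTransversality`/`OddSectorGreenKubo`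
the STATIC odd norms; the (S) items grade ONE bond); the graded door, the proved necessity of the ceiling and the (S)-seam are new.  Tags:
(HSᴾ_3)/(HSᵂ_1) UNDECIDED · phonon-FALSE · IDEA-NEEDED (bulk energy diffusion before the Thouless time = the output of the kinetic /
hydrodynamic-limit engines); (TCᶜ_3) UNDECIDED · NECESSARY (proved) · phonon-compatible · INSTRUMENTABLE; (TFᶜ_3) UNDECIDED; (TBC) WEAKER ·
fixed-`N` · ATTACKABLE·M; (HSᵁ) UNDECIDED · ⟹ 11071.  [folklore] on objects and fixed-`N` seams (Helfand 1960; Kundu–Dhar–Narayan 2009;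
Liu–Hänggi–Li–Ren–Li 2014 for the spreading ⟷ autocorrelation dictionary).  0 sorry · standard axioms · tree imports only.
-/


noncomputable section

open MeasureTheory ProbabilityTheory Filter Topology Set Function
open scoped NNReal ENNReal
open Literature.MathematicalPhysics.KineticTheory.HeatConduction
open Literature.MathematicalPhysics.KineticTheory OscillatorChain
open Summit.AtomisticToContinuum.FouriersLaw.Theorems.SubdiffusiveBondHeat
open Summit.AtomisticToContinuum.FouriersLaw.Theorems.SubdiffusiveBondHeat.EscapeGrading
open Summit.AtomisticToContinuum.FouriersLaw.Theorems.OddSectorIrreversibility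

namespace Summit.AtomisticToContinuum.FouriersLaw.Theorems.BoundedResponse.HeatSpreading

open Summit.AtomisticToContinuum.FouriersLaw.Theses.BondHeatUncertainty (BoundedResponse SubdiffusiveBondHeat)
open Summit.AtomisticToContinuum.FouriersLaw.Theorems.BoundedResponse.TransientBand (integral_min_mul_eq_sub)
open Summit.AtomisticToContinuum.FouriersLaw.Theorems.LightConeBondHeat (pinnedChain_autocorr_abs_le)
open Summit.AtomisticToContinuum.FouriersLaw.Theorems.BoundedResponse.TransientContact (gibbsBondHeatVar gibbsBondCorr)
open Summit.AtomisticToContinuum.FouriersLaw.Theorems.BoundedResponse.ParityFloor (exists_integral_totalCurrent_sq_gibbsMeasure_le)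

/-! ## §0 The objects -/

/-- **The total-current autocorrelation `C_N(s) = ∫ J · (P_s J) dμ_T`**, `J = ∑_i j_i` — VERBATIM the integrand of conjunct B of
`OddSectorIrreversibility.CorrectorTheory` (PROVED, `CorrectorTheory_proof`): the UNCENTRED kernel form (cf. the centred semigroup-vocabulary
`JunctionLocality.totalCorr` of another route — equal, since `⟨J⟩_{μ_T} = 0`; not imported here). [folklore] -/
def totalAutocorr (ω₂ lam β γ T : ℝ) (N : ℕ) (s : ℝ) : ℝ :=
  ∫ z, (∑ i : Fin N, (pinnedChain ω₂ lam β γ).bondCurrent N i z) *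
      (∫ y, (∑ i : Fin N, (pinnedChain ω₂ lam β γ).bondCurrent N i y)
        ∂((pinnedChain ω₂ lam β γ).transitionKernel N T T s.toNNReal z))
    ∂((pinnedChain ω₂ lam β γ).gibbsMeasure N T)

/-- **The heat-spreading functional `V_N(t) = 2∫₀ᵗ (t − s) C_N(s) ds`** — the Einstein–Helfand second moment of `∫₀ᵗ J`
(`heatSpread_eq_integral_sq`). [folklore] -/
def heatSpread (ω₂ lam β γ T : ℝ) (N : ℕ) (t : ℝ) : ℝ :=
  2 * ∫ s in (0 : ℝ)..t, (t - s) * totalAutocorr ω₂ lam β γ T N s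

/-- **The Green–Kubo tail functional `Tr_N(t) = ∫_{(0,∞)} min(s,t) C_N(s) ds`.** [folklore] -/
def gkTail (ω₂ lam β γ T : ℝ) (N : ℕ) (t : ℝ) : ℝ :=
  ∫ s in Ioi (0 : ℝ), min s t * totalAutocorr ω₂ lam β γ T N s

/-- **The open-chain Green–Kubo integral `G_N = ∫_{(0,∞)} C_N(s) ds`** (`= (N−1)T²·D_N = γT²(N−1)²·E_N`, `totalGK_eq`). [folklore] -/
def totalGK (ω₂ lam β γ T : ℝ) (N : ℕ) : ℝ :=
  ∫ s in Ioi (0 : ℝ), totalAutocorr ω₂ lam β γ T N s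

section FixedN

variable {ω₂ lam β γ T : ℝ} (hω : 0 < ω₂) (hl : 0 < lam) (hβ : 0 < β) (hγ : 0 < γ) (hT : 0 < T)
include hω hl hβ hγ hT

/-! ## §1 Green–Kubo at fixed `N`: `C_N ∈ L¹(0,∞)` and `G_N = γT²(N−1)²E_N` -/

/-- **`C_N ∈ L¹(0,∞)` and `G_N = γ T² (N−1)² E_N`** for `N ≥ 1`: conjunct B of `CorrectorTheory_proof` along the canonical
steady-state family (`pinnedChain_exists_isSteadyState`), with the response coefficient `D_N = (N−1)γE_N` supplied by the PROVED
`ResponseIdentity` (`boundaryEscapeDeficit_responseIdentity_holds`) and weak-NESS uniqueness (`bondHeatUncertainty_nessUnique_holds`).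
[folklore] -/
theorem integrableOn_totalAutocorr_and_totalGK_eq {N : ℕ} (hN : 0 < N) :
    IntegrableOn (totalAutocorr ω₂ lam β γ T N) (Ioi 0) ∧
      totalGK ω₂ lam β γ T N = γ * T ^ 2 * ((N : ℝ) - 1) ^ 2 * escapeDeficit ω₂ lam β γ T N := by
  classical
  have huniq := bondHeatUncertainty_nessUnique_holds ω₂ lam β γ hω hl hβ hγ
  -- the canonical steady-state family
  let μ₀ : (n : ℕ) → ℝ → ℝ → Measure (PhaseSpace n) := fun n T_L T_R =>
    if h : 0 < T_L ∧ 0 < T_R then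
      Classical.choose (pinnedChain_exists_isSteadyState hω hl hβ hγ n h.1 h.2) else 0
  have hμ₀ : ∀ (n : ℕ) (T_L T_R : ℝ), 0 < T_L → 0 < T_R →
      (pinnedChain ω₂ lam β γ).IsSteadyState n T_L T_R (μ₀ n T_L T_R) := by
    intro n T_L T_R hL' hR'
    simp only [μ₀, dif_pos (And.intro hL' hR')]
    exact Classical.choose_spec (pinnedChain_exists_isSteadyState hω hl hβ hγ n hL' hR')
  have hRI := boundaryEscapeDeficit_responseIdentity_holds ω₂ lam β γ hω hl hβ hγ huniq μ₀ hμ₀ T hT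
  dsimp only at hRI
  have hD : Tendsto (fun δ : ℝ => (pinnedChain ω₂ lam β γ).totalCurrent (μ₀ N (T + δ / 2) (T - δ / 2)) / δ)
      (𝓝[≠] 0) (𝓝 (((N : ℝ) - 1) * γ * escapeDeficit ω₂ lam β γ T N)) := (hRI N hN).2
  have hCT :=
    Summit.AtomisticToContinuum.FouriersLaw.Theorems.OddSectorIrreversibility.Corrector.CorrectorTheory_proof
  obtain ⟨hcI, hGKB⟩ := hCT.2 ω₂ lam β γ hω hl hβ hγ huniq μ₀ hμ₀ T hT N _ hD
  simp only [] at hcI hGKB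
  refine ⟨hcI, ?_⟩
  unfold totalGK totalAutocorr
  rw [← hGKB]
  ring

/-- `C_N ∈ L¹(0,∞)` (`N ≥ 1`). [folklore] -/
theorem integrableOn_totalAutocorr {N : ℕ} (hN : 0 < N) : IntegrableOn (totalAutocorr ω₂ lam β γ T N) (Ioi 0) :=
  (integrableOn_totalAutocorr_and_totalGK_eq hω hl hβ hγ hT hN).1

/-- **`G_N = γ T² (N−1)² E_N`** (`N ≥ 1`): the blocker's scalar in Green–Kubo currency. [folklore] -/
theorem totalGK_eq {N : ℕ} (hN : 0 < N) :
    totalGK ω₂ lam β γ T N = γ * T ^ 2 * ((N : ℝ) - 1) ^ 2 * escapeDeficit ω₂ lam β γ T N :=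
  (integrableOn_totalAutocorr_and_totalGK_eq hω hl hβ hγ hT hN).2

/-- **`0 ≤ G_N ≤ γT²(N−1)²`** for `N ≥ 2` (`0 ≤ E_N ≤ 1`: `escapeDeficit_nonneg'`, `escapeDeficit_le_one`). [folklore] -/
theorem totalGK_nonneg_and_le {N : ℕ} (hN : 2 ≤ N) :
    0 ≤ totalGK ω₂ lam β γ T N ∧ totalGK ω₂ lam β γ T N ≤ γ * T ^ 2 * ((N : ℝ) - 1) ^ 2 := by
  have hE0 := escapeDeficit_nonneg' hω hl hβ hγ hT hN
  have hE1 : escapeDeficit ω₂ lam β γ T N ≤ 1 := escapeDeficit_le_one ω₂ lam β γ hω hl hβ hγ T hT N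
  rw [totalGK_eq hω hl hβ hγ hT (by omega)]
  have hK : 0 ≤ γ * T ^ 2 * ((N : ℝ) - 1) ^ 2 := by positivity
  exact ⟨mul_nonneg hK hE0, by nlinarith⟩

/-! ## §2 Kernel contraction and the path-space dictionary: `|C_N| ≤ ‖J‖²`, `0 ≤ V_N ≤ ‖J‖² t²` -/

/-- **`|C_N(s)| ≤ ‖J‖²_{μ_T}`** (`N ≥ 1`): kernel contraction (`LightConeBondHeat.pinnedChain_autocorr_abs_le` with the exponential
domination of `J` at `ϑ = 1/(4T)`). [folklore] -/
theorem abs_totalAutocorr_le {N : ℕ} (hN : 0 < N) (s : ℝ) :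
    |totalAutocorr ω₂ lam β γ T N s| ≤
      ∫ z, (∑ i : Fin N, (pinnedChain ω₂ lam β γ).bondCurrent N i z) ^ 2 ∂((pinnedChain ω₂ lam β γ).gibbsMeasure N T) := by
  have hϑ0 : 0 < 1 / (4 * T) := by positivity
  have h2ϑ : 2 * (1 / (4 * T)) < 1 / T := by
    have h2 : 2 * (1 / (4 * T)) = 1 / (2 * T) := by field_simp; ring
    rw [h2]
    exact one_div_lt_one_div_of_lt hT (by linarith)
  have h := pinnedChain_autocorr_abs_le hω hl.le hβ hγ hN hT hϑ0 h2ϑ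
    (pinnedChain_continuous_sum_bondCurrent (ω₂ := ω₂) (lam := lam) (β := β) (γ := γ) (N := N))
    (pinnedChain_abs_sum_bondCurrent_le_exp hω.le hl.le hβ.le γ N hϑ0) s.toNNReal
  simpa [totalAutocorr] using h

/-- **`V_N(t) = E_{μ_T ⊗ W}[(∫₀ᵗ J(z_s) ds)²]`** (`t ≥ 0`, `N ≥ 1`): the heat-spreading functional IS the second moment of the
time-integrated total current along the stationary constructed flow (`pinnedChain_integral_sq_intervalIntegral_of_invariant` fed with
the kernel Gibbs invariance `pinnedChain_gibbsMeasure_bind_transitionKernel` and `J ∈ L²(μ_T)`). [folklore] -/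
theorem heatSpread_eq_integral_sq {N : ℕ} (hN : 0 < N) {t : ℝ} (ht : 0 ≤ t) :
    heatSpread ω₂ lam β γ T N t =
      ∫ p, (∫ s in (0 : ℝ)..t, (∑ i : Fin N, (pinnedChain ω₂ lam β γ).bondCurrent N i
          ((pinnedChain ω₂ lam β γ).solMap N T T s p.1 (Literature.Probability.Process.pairPath p.2)))) ^ 2
        ∂(((pinnedChain ω₂ lam β γ).gibbsMeasure N T).prod Literature.Probability.Process.wienerPair) := by
  haveI := pinnedChain_isProbabilityMeasure_gibbsMeasure hω hl.le hβ.le γ N hT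
  have h := pinnedChain_integral_sq_intervalIntegral_of_invariant hω hl.le hβ.le hγ.le N T T
    ((pinnedChain ω₂ lam β γ).gibbsMeasure N T)
    (fun s => pinnedChain_gibbsMeasure_bind_transitionKernel hω hl.le hβ.le hγ.le hN hT s)
    (pinnedChain_continuous_sum_bondCurrent (ω₂ := ω₂) (lam := lam) (β := β) (γ := γ) (N := N)).measurable
    (pinnedChain_sq_act_sum_bondCurrent hω hl.le hβ hγ hN hT 0).1 ht
  rw [h]
  rfl

/-- **`V_N(t) ≥ 0`** for `t ≥ 0` (`N ≥ 1`). [folklore] -/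
theorem heatSpread_nonneg {N : ℕ} (hN : 0 < N) {t : ℝ} (ht : 0 ≤ t) : 0 ≤ heatSpread ω₂ lam β γ T N t := by
  rw [heatSpread_eq_integral_sq hω hl hβ hγ hT hN ht]
  exact integral_nonneg fun p => sq_nonneg _

/-- **The ballistic (free) bound `V_N(t) ≤ ‖J‖²_{μ_T}·t²`** for `t ≥ 0` (`N ≥ 1`): `|C_N| ≤ ‖J‖²` and `2∫₀ᵗ(t−s)ds = t²`. [folklore] -/
theorem heatSpread_le_normSq_mul_sq {N : ℕ} (hN : 0 < N) {t : ℝ} (ht : 0 ≤ t) :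
    heatSpread ω₂ lam β γ T N t ≤
      (∫ z, (∑ i : Fin N, (pinnedChain ω₂ lam β γ).bondCurrent N i z) ^ 2 ∂((pinnedChain ω₂ lam β γ).gibbsMeasure N T)) *
        t ^ 2 := by
  set M := ∫ z, (∑ i : Fin N, (pinnedChain ω₂ lam β γ).bondCurrent N i z) ^ 2
    ∂((pinnedChain ω₂ lam β γ).gibbsMeasure N T) with hM
  have hCi : IntegrableOn (totalAutocorr ω₂ lam β γ T N) (Ioc 0 t) :=
    (integrableOn_totalAutocorr hω hl hβ hγ hT hN).mono_set Ioc_subset_Ioi_self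
  have hi1 : IntegrableOn (fun s => (t - s) * totalAutocorr ω₂ lam β γ T N s) (Ioc 0 t) := by
    refine Integrable.bdd_mul (c := t) hCi ?_ ?_
    · exact (measurable_const.sub measurable_id).aestronglyMeasurable
    · refine ae_restrict_of_forall_mem measurableSet_Ioc fun u hu => ?_
      rw [Real.norm_eq_abs, abs_of_nonneg (by linarith [hu.2])]
      linarith [hu.1]
  have hi2 : IntegrableOn (fun s => (t - s) * M) (Ioc 0 t) :=
    (continuous_const.sub continuous_id).mul continuous_const |>.integrableOn_Ioc
  have hle : ∫ s in Ioc 0 t, (t - s) * totalAutocorr ω₂ lam β γ T N s ≤ ∫ s in Ioc 0 t, (t - s) * M := by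
    refine setIntegral_mono_on hi1 hi2 measurableSet_Ioc fun s hs => ?_
    have hts : 0 ≤ t - s := by linarith [hs.2]
    have hC := (abs_le.1 (abs_totalAutocorr_le hω hl hβ hγ hT hN s)).2
    exact mul_le_mul_of_nonneg_left hC hts
  have hval : ∫ s in Ioc 0 t, (t - s) * M = M * t ^ 2 / 2 := by
    rw [← intervalIntegral.integral_of_le ht, intervalIntegral.integral_mul_const]
    have h1 : ∫ x in (0 : ℝ)..t, (t - x) = t ^ 2 / 2 := by
      rw [intervalIntegral.integral_sub intervalIntegrable_const (continuous_id'.intervalIntegrable _ _),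
        intervalIntegral.integral_const, integral_id, smul_eq_mul]
      ring
    rw [h1]
    ring
  unfold heatSpread
  rw [intervalIntegral.integral_of_le ht]
  calc 2 * ∫ s in Ioc 0 t, (t - s) * totalAutocorr ω₂ lam β γ T N s ≤ 2 * (M * t ^ 2 / 2) := by
        rw [← hval]; exact mul_le_mul_of_nonneg_left hle (by norm_num)
    _ = M * t ^ 2 := by ring

/-! ## §3 The Einstein–Helfand identity `t·G_N = V_N(t)/2 + Tr_N(t)` and its consequences -/

/-- **`t·G_N = V_N(t)/2 + Tr_N(t)`** for `t ≥ 0` (`N ≥ 1`): `t = (t − s)₊ + min(s,t)` on `s > 0` against `C_N ∈ L¹(0,∞)`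
(`TransientBand.integral_min_mul_eq_sub`). [folklore] -/
theorem mul_totalGK_eq {N : ℕ} (hN : 0 < N) {t : ℝ} (ht : 0 ≤ t) :
    t * totalGK ω₂ lam β γ T N = heatSpread ω₂ lam β γ T N t / 2 + gkTail ω₂ lam β γ T N t := by
  have h := integral_min_mul_eq_sub (integrableOn_totalAutocorr hω hl hβ hγ hT hN) ht
  unfold totalGK heatSpread gkTail
  rw [h]
  ring

/-- **`Tr_N(t) ≤ t·G_N`** for `t ≥ 0` (`N ≥ 1`): the free sign `V_N ≥ 0` in the Einstein–Helfand identity. [folklore] -/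
theorem gkTail_le {N : ℕ} (hN : 0 < N) {t : ℝ} (ht : 0 ≤ t) :
    gkTail ω₂ lam β γ T N t ≤ t * totalGK ω₂ lam β γ T N := by
  have h := mul_totalGK_eq hω hl hβ hγ hT hN ht
  have hV := heatSpread_nonneg hω hl hβ hγ hT hN ht
  linarith

/-- **`V_N(t) = 2(t·G_N − Tr_N(t))`** (`t ≥ 0`, `N ≥ 1`): the Einstein–Helfand identity solved for the spreading. [folklore] -/
theorem heatSpread_eq_two_mul_sub {N : ℕ} (hN : 0 < N) {t : ℝ} (ht : 0 ≤ t) :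
    heatSpread ω₂ lam β γ T N t = 2 * (t * totalGK ω₂ lam β γ T N - gkTail ω₂ lam β γ T N t) := by
  have h := mul_totalGK_eq hω hl hβ hγ hT hN ht
  linarith

/-- **`t·G_N − ‖J‖²_{μ_T}·t²/2 ≤ Tr_N(t)`** (`t ≥ 0`, `N ≥ 1`): the ballistic bound `V_N ≤ ‖J‖²t²` in the Einstein–Helfand identity —
the free FLOOR side of the tail functional (feeds `gkTailFloor_five`). [folklore] -/
theorem mul_totalGK_sub_le_gkTail {N : ℕ} (hN : 0 < N) {t : ℝ} (ht : 0 ≤ t) :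
    t * totalGK ω₂ lam β γ T N -
        (∫ z, (∑ i : Fin N, (pinnedChain ω₂ lam β γ).bondCurrent N i z) ^ 2 ∂((pinnedChain ω₂ lam β γ).gibbsMeasure N T)) *
          t ^ 2 / 2 ≤ gkTail ω₂ lam β γ T N t := by
  have h := mul_totalGK_eq hω hl hβ hγ hT hN ht
  have hV := heatSpread_le_normSq_mul_sq hω hl hβ hγ hT hN ht
  linarith

/-! ## §4 Einstein–Helfand = Green–Kubo at fixed `N`: `Tr_N(t)/t → 0`, `V_N(t)/(2t) → G_N` -/

/-- **`Tr_N(t)/t → 0` as `t → ∞`** (fixed `N ≥ 1`): dominated convergence (`|min(s,t)/t · C_N(s)| ≤ |C_N(s)| ∈ L¹(0,∞)`,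
`min(s,t)/t → 0` pointwise). [folklore] -/
theorem tendsto_gkTail_div {N : ℕ} (hN : 0 < N) :
    Tendsto (fun t : ℝ => gkTail ω₂ lam β γ T N t / t) atTop (𝓝 0) := by
  have hCi := integrableOn_totalAutocorr hω hl hβ hγ hT hN
  set C := totalAutocorr ω₂ lam β γ T N with hC
  -- rewrite the quotient as one integral, eventually in `t`
  have hev : (fun t : ℝ => gkTail ω₂ lam β γ T N t / t) =ᶠ[atTop]
      fun t : ℝ => ∫ s in Ioi (0 : ℝ), min s t / t * C s := by
    filter_upwards [eventually_gt_atTop (0 : ℝ)] with t ht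
    unfold gkTail
    rw [← integral_div]
    refine integral_congr_ae (ae_of_all _ fun s => ?_)
    ring
  refine Tendsto.congr' hev.symm ?_
  have hlim : Tendsto (fun t : ℝ => ∫ s in Ioi (0 : ℝ), min s t / t * C s) atTop
      (𝓝 (∫ s in Ioi (0 : ℝ), (0 : ℝ) * C s)) := by
    refine tendsto_integral_filter_of_dominated_convergence (fun s => |C s|) ?_ ?_ hCi.abs ?_
    · filter_upwards with t
      exact ((continuous_id.min continuous_const).div_const t).aestronglyMeasurable.mul hCi.aestronglyMeasurable
    · filter_upwards [eventually_gt_atTop (0 : ℝ)] with t ht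
      refine ae_restrict_of_forall_mem measurableSet_Ioi fun s hs => ?_
      rw [Real.norm_eq_abs, abs_mul]
      have h1 : |min s t / t| ≤ 1 := by
        rw [abs_of_nonneg (div_nonneg (le_min (le_of_lt hs) ht.le) ht.le)]
        exact (div_le_one ht).2 (min_le_right s t)
      calc |min s t / t| * |C s| ≤ 1 * |C s| := mul_le_mul_of_nonneg_right h1 (abs_nonneg _)
        _ = |C s| := one_mul _
    · refine ae_of_all _ fun s => ?_
      refine Tendsto.mul ?_ tendsto_const_nhds
      have h2 : (fun t : ℝ => min s t / t) =ᶠ[atTop] fun t : ℝ => s * t⁻¹ := by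
        filter_upwards [eventually_ge_atTop s] with t ht
        rw [min_eq_left ht, div_eq_mul_inv]
      refine Tendsto.congr' h2.symm ?_
      simpa using tendsto_inv_atTop_zero.const_mul s
  simpa using hlim

/-- **Einstein–Helfand = Green–Kubo (fixed `N ≥ 1`): `V_N(t)/(2t) → G_N`** as `t → ∞`. [folklore] -/
theorem tendsto_heatSpread_div {N : ℕ} (hN : 0 < N) :
    Tendsto (fun t : ℝ => heatSpread ω₂ lam β γ T N t / (2 * t)) atTop (𝓝 (totalGK ω₂ lam β γ T N)) := by
  have hev : (fun t : ℝ => heatSpread ω₂ lam β γ T N t / (2 * t)) =ᶠ[atTop]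
      fun t : ℝ => totalGK ω₂ lam β γ T N - gkTail ω₂ lam β γ T N t / t := by
    filter_upwards [eventually_gt_atTop (0 : ℝ)] with t ht
    rw [heatSpread_eq_two_mul_sub hω hl hβ hγ hT hN ht.le]
    field_simp
  refine Tendsto.congr' hev.symm ?_
  simpa using (tendsto_const_nhds (x := totalGK ω₂ lam β γ T N)).sub (tendsto_gkTail_div hω hl hβ hγ hT hN)

end FixedN

end Summit.AtomisticToContinuum.FouriersLaw.Theorems.BoundedResponse.HeatSpreading

end
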